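import Summits.ABC.IUTFork.Repair.RHLabelCutJ2
import Summits.ABC.IUTFork.Repair.RHLabelCutJ3
import HarnessLib

/-!
# R-H ROUND 1 row 1 `label-cut-j2`: the BRIDGE between the two typings of H⋆₁ at the genuine bed —
# abc-iut-rh-typ-1's `RH.LabelCutJ2` (column door `PosDoorJ2`, two-element cells `HStarGenuine`, integer door `doorJ2`) and
# abc-iut-rh-typ-9's C1 family `RH.LabelCutJ3.StarBelow D tq 2` (root-form cells, integer door `PosDoor p e P 2`)

PROOF-ONLY file (0 definitions, 0 `Prop` facts; abc-iut cell, rung LADDER-ABC:A2.RESCUE.H; seat abc-iut-rh-typ-1, R-H ROUND 1 pair 1 typer;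
asked by abc-iut-rh-tst-1 g2 18:03:37Z «which typed decl is row 1's»). TAKES NO SIDE on [IUTchIII] Cor. 3.12 or on any author; candidates are
hypotheses; typed ≠ proved. Everything consumed BY NAME: `RH.LabelCutJ2.PosDoorJ2` / `doorJ2` / `aNum` (p459899), `RH.LabelCutJ3.StarBelow` /
`PosDoor` (p459152), abc-iut-rp-x3's `EvalI06StarGenuine.norm_qIdele_eq_rpow_of_realises`, abc-iut-rp-d2's
`CandInternal2RealLabels.mem_pow_smul_logShell_of_height_le`, abc-iut-rp-h3's `CandInternal11GapLabelCutArith.lowerEdge_nonneg`,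
abc-iut-S1's `absRamificationIdx_rescaledCompletion`. Standard axioms.

* `doorJ2_eq_true_iff_posDoor_two` — for odd `p` and `l, e > 0` the two INTEGER doors are the same inequality `3P + ⌈e/(p−2)⌉ ≤ e`
  (`doorJ2 p e l (2l·P) e = true ⟺ PosDoor p e P 2`; `ord_w(q) = 2l·P_w`).
* **`starBelow_two_of_posDoorJ2`** — ROW 1's column door `PosDoorJ2 D` gives abc-iut-rh-typ-9's root-form cut `StarBelow D tq 2` for EVERY realising
  q-idele (as it gives `HStarGenuine D t tq` for every realising pair, `hStarGenuine_of_posDoorJ2`): ONE door, two cell currencies; a k2/k3 test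
  may cite either typing by name.
[cite: MochizukiAbsTopIII2015, Def 5.4 (iii) p. 126] [cite: DupuyHilado2025, §3.4] [claim: Mochizuki2012, status: disputed]. Axioms: standard.
-/

noncomputable section

open Set Metric Function NumberField IsDedekindDomain
open scoped Pointwise

namespace Summit.ABC.IUTFork.Repair.RH.LabelCutJ2

open Literature.AnabelianGeometry.AbsoluteAnabelian Literature.IUT.LogThetaLattice Literature.IUT.LogVolume
  Literature.IUT.HodgeTheaters
open Summit.ABC.IUTFork.Thm311 Summit.ABC.IUTFork.Thm311.Real Summit.ABC.IUTFork.Cor312 Summit.ABC.IUTFork.Cor312Vol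
  Summit.ABC.IUTFork.Cor312Prov Summit.ABC.IUTFork.Repair.CandInternal2Real Summit.ABC.IUTFork.Repair.CandInternal2RealLabels
  Summit.ABC.IUTFork.Repair.CandInternal11GapLabelCutArith Summit.ABC.IUTFork.Repair.EvalI06StarGenuine

/-! ## §1. The two integer doors coincide at `j = 2` (odd `p`) -/

/-- **ONE INTEGER DOOR**: for odd `p`, `l > 0`, `e > 0` and `ord_w(q) = 2l·P`: `doorJ2 p e l (2l·P) e = true ⟺ RH.LabelCutJ3.PosDoor p e P 2`
(both say `3P + ⌈e/(p−2)⌉ ≤ e`). [folklore] -/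
theorem doorJ2_eq_true_iff_posDoor_two {p e l P : ℕ} (hp : p ≠ 2) (hl : 0 < l) (he : 0 < e) :
    doorJ2 p e l (2 * l * P) e = true ↔ RH.LabelCutJ3.PosDoor p e P 2 := by
  unfold doorJ2 aNum RH.LabelCutJ3.PosDoor
  rw [decide_eq_true_iff, if_neg hp, if_neg hp]
  generalize (e + (p - 3)) / (p - 2) = A
  have hk : 0 < 2 * l * e := by positivity
  have h1 : 3 * (2 * l * P) * e + 2 * l * e * A = (2 * l * e) * (3 * P + A) := by ring
  have h2 : 2 * l * e * 1 * e = (2 * l * e) * e := by ring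
  rw [h1, h2, show (2 : ℕ) ^ 2 = 4 from rfl]
  constructor
  · intro h
    have := Nat.le_of_mul_le_mul_left h hk
    omega
  · intro h
    exact Nat.mul_le_mul_left _ (by omega)

/-! ## §2. Row 1's column door decides abc-iut-rh-typ-9's root-form cut at `j₀ = 2` -/

section Genuine

variable {F K Fbar : Type} [Field F] [NumberField F] [Field K] [NumberField K] [Algebra F K] [Field Fbar]
  [Algebra F Fbar] [Algebra K Fbar] {E : WeierstrassCurve F} [E.IsElliptic] {l : ℕ} {Pb : BadPlacePredicates K}
  (D : InitialThetaData F K Fbar E l Pb)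
  (tq : ∀ (pp : Nat.Primes) (x : (thetaIndex (pilotDataOfK D K)).Fibre (.inr pp)),
    haveI : Fact (pp : ℕ).Prime := ⟨pp.2⟩; kOf (pilotDataOfK D K) pp.1 x)
  (htq0 : ∀ pp x, tq pp x ≠ 0)
  (htq : ∀ (pp : Nat.Primes) (x : (thetaIndex (pilotDataOfK D K)).Fibre (.inr pp)),
    haveI : Fact (pp : ℕ).Prime := ⟨pp.2⟩
    Real.log ‖tq pp x‖ = -((pilotDataOfK D K).qPilot (placeOf (pilotDataOfK D K) pp.1 x)) *
      logNorm K (placeOf (pilotDataOfK D K) pp.1 x) / localDegree K (placeOf (pilotDataOfK D K) pp.1 x))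

include htq0 htq in
/-- **ROW 1's COLUMN DOOR ⟹ abc-iut-rh-typ-9's ROOT-FORM CUT AT `j₀ = 2`**: `PosDoorJ2 D` (`∀ bad x: 3·ord_x(q) ≤ 2l·e_x·(c − a_{e_x})`) gives
`RH.LabelCutJ3.StarBelow D tq 2` (`t_{q,x} ∈ t_{q,x}^{j²}·ℐ_x` at every bad `x`, `j ≤ 2`) for EVERY realising q-idele `tq`
(`‖t_{q,x}‖ = p^{−ord_x(q)/(2l·e_x)}`, abc-iut-rp-x3; abc-iut-rp-d2's sufficient height window; label `1` by `lowerEdge_nonneg`).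
[cite: MochizukiAbsTopIII2015, Def 5.4 (iii) p. 126] [cite: DupuyHilado2025, §3.4] [claim: Mochizuki2012, status: disputed] -/
theorem starBelow_two_of_posDoorJ2 (hdoor : PosDoorJ2 D) : RH.LabelCutJ3.StarBelow D tq 2 := by
  intro pp i w hw hi
  haveI : Fact (pp : ℕ).Prime := ⟨pp.2⟩
  have hqh := norm_qIdele_eq_rpow_of_realises (pilotDataOfK D K) tq htq0 htq pp w hw
  have heK : absRamificationIdx (pp : ℕ) (kOf (pilotDataOfK D K) pp.1 w) =
      (placeOf (pilotDataOfK D K) pp.1 w).asIdeal.ramificationIdx ℤ :=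
    absRamificationIdx_rescaledCompletion K (pp : ℕ) (placeOf (pilotDataOfK D K) pp.1 w)
      (natCast_mem_placeOf (pilotDataOfK D K) pp.1 w)
  have he0 : 0 < (placeOf (pilotDataOfK D K) pp.1 w).asIdeal.ramificationIdx ℤ := Ideal.ramificationIdx_pos _ _
  have he : (0 : ℝ) < ((placeOf (pilotDataOfK D K) pp.1 w).asIdeal.ramificationIdx ℤ : ℝ) := by exact_mod_cast he0
  have hl : (0 : ℝ) < ((pilotDataOfK D K).l : ℝ) := by
    have h5 := (pilotDataOfK D K).five_le_l
    exact_mod_cast (by omega : 0 < (pilotDataOfK D K).l)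
  have hκ := lowerEdge_nonneg (e := (placeOf (pilotDataOfK D K) pp.1 w).asIdeal.ramificationIdx ℤ) pp.2 he0
  refine mem_pow_smul_logShell_of_height_le (pp : ℕ) (kOf (pilotDataOfK D K) pp.1 w) (htq0 pp w) hqh ?_
  rw [heK]
  rcases Nat.lt_or_ge (i : ℕ) 1 with h0 | h1
  · have hi0 : (i : ℕ) = 0 := by omega
    have h0' : ((((i : ℕ) + 1) ^ 2 : ℕ) : ℝ) - 1 = 0 := by rw [hi0]; norm_num
    rw [h0', zero_mul]
    exact hκ
  · have hi1 : (i : ℕ) = 1 := by omega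
    have h3 : ((((i : ℕ) + 1) ^ 2 : ℕ) : ℝ) - 1 = 3 := by rw [hi1]; norm_num
    rw [h3]
    have hd := hdoor pp w hw
    have hpos : (0 : ℝ) < 2 * ((pilotDataOfK D K).l : ℝ) * ((placeOf (pilotDataOfK D K) pp.1 w).asIdeal.ramificationIdx ℤ : ℝ) := by
      positivity
    rw [← mul_div_assoc, div_le_iff₀ hpos]
    linarith

include htq0 htq in
/-- Hence, with abc-iut-rh-typ-1's integer column door at every bad place (`doorJ2 p e_x l ord_x(q) e_x = true`), the root-form cut at
`j₀ = 2` holds as well (`posDoorJ2_of_doorJ2`). [claim: Mochizuki2012, status: disputed] -/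
theorem starBelow_two_of_doorJ2
    (hcol : ∀ (pp : Nat.Primes) (x : (thetaIndex (pilotDataOfK D K)).Fibre (.inr pp)),
      haveI : Fact (pp : ℕ).Prime := ⟨pp.2⟩
      placeOf (pilotDataOfK D K) pp.1 x ∈ (pilotDataOfK D K).S →
        doorJ2 (pp : ℕ) ((placeOf (pilotDataOfK D K) pp.1 x).asIdeal.ramificationIdx ℤ) l
          ((pilotDataOfK D K).ordq (placeOf (pilotDataOfK D K) pp.1 x)).toNat
          ((placeOf (pilotDataOfK D K) pp.1 x).asIdeal.ramificationIdx ℤ) = true) :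
    RH.LabelCutJ3.StarBelow D tq 2 :=
  starBelow_two_of_posDoorJ2 D tq htq0 htq (posDoorJ2_of_doorJ2 D hcol)

end Genuine

end Summit.ABC.IUTFork.Repair.RH.LabelCutJ2

end
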